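import Mathlib.NumberTheory.Zsqrtd.GaussianInt
import Literature.NumberTheory.Sieve.FriedlanderIwaniecPrimes
import HarnessLib

/-!
# Friedlander–Iwaniec, *The polynomial `X² + Y⁴` captures its primes*, §5: the Gaussian parametrisation (5.2)

Family `parity`, statement parity.S17 (`setOf_prime_sq_add_pow_four_infinite`). Source: J. Friedlander,
H. Iwaniec, Ann. of Math. (2) 148 (1998), 945–1040 [FriedlanderIwaniecAnnals1998], §5 "The bilinear
form in the sieve: Transformations", (5.1)–(5.2): "we shall write the solutions `a² + b² = mn` in
`a, b ∈ ℤ` in terms of Gaussian integers `w, z ∈ ℤ[i]` … Since `(m, n) = 1` we have by the unique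
factorization in `ℤ[i]` (5.2) `a_{mn} = ¼ Σ_{|w|²=m} Σ_{|z|²=n} 𝔷(Re w̄ z)` where `¼` accounts for
the four units `1, i, i², i³` in `ℤ[i]`."

This is the entry point of the transformation of the forms `B*(M, N)` of (4.20)–(4.23)
(`FriedlanderIwaniec1998_bilinear423`) into the free bilinear forms over Gaussian integers
(5.6)–(5.15). Everything in this file is PROVED.

## Main result

`four_mul_fiRepCount_eq_sum`: for coprime `m, n` (`n ≥ 1`),
`4 a_{mn} = Σ_{u² + v² = m} Σ_{r² + s² = n} 𝔷(ur + vs)`, where `a_k = fiRepCount k =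
#{(a, c) ∈ ℤ² : a² + c⁴ = k}` (FI (4.1)), `𝔷(b) = #{c ∈ ℤ : c² = b}` (FI (3.14), `fiZeta`), the sums
run over all lattice points on the two circles (`sqPairs`), and `ur + vs = Re(w̄ z)` for `w = u + iv`,
`z = r + is` (`gaussMulConj`, `toGauss_gaussMulConj`).

## Proof

* `fiRepCount_eq_sum_fiZeta`: `a_k = Σ_{x² + y² = k} 𝔷(x)` ((3.1)/(3.14): `(a, c) ↦ (ζ, c)`,
  `ζ = c² + ia`).
* The map `Φ(w, z) = w̄ z` sends `{N(w) = m} × {N(z) = n}` to `{N(ζ) = mn}` and is EXACTLY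
  four-to-one there (`card_gaussFibre`):
  - `norm_gcd_eq`: for `N(ζ) = mn`, `(m, n) = 1`, the Gaussian integer `g = gcd(ζ, n)`
    (Mathlib's Euclidean `ℤ[i]`) has `N(g) = n` — Bezout `g = ζa + nb` gives `n ∣ g ḡ`, while `g ḡ`
    divides `ζ ζ̄ = mn` and `n²`, hence `n = u·mn + v·n²`; so `g ḡ ~ n` and the norms agree;
  - `exists_gauss_factor`: `z = g`, `w̄ = ζ/g` is a factorisation;
  - `gauss_factor_unique`: any admissible `z` divides `ζ` and `n`, hence `g`, with a cofactor of
    norm `1`; so two factorisations differ by a unit `ε` (`w = εw₀`, `z = εz₀`);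
  - the fibre is therefore the orbit of one factorisation under the four units (`sqPairs_one`).
* Summing `𝔷(Re Φ(w, z))` fibrewise gives `4 Σ_{N(ζ) = mn} 𝔷(Re ζ) = 4 a_{mn}`.

## Contents

`fiZeta`, `sqPairs` (+ `mem_sqPairs`, `sqPairs_one`), `toGauss`/`ofGauss` (coordinates on
`GaussianInt`), `gaussMulConj`, `gaussFibre`, and the theorems above.

## References

* J. Friedlander, H. Iwaniec, Ann. of Math. (2) 148 (1998), 945–1040, §3 (3.1), (3.14), §5
  (5.1)–(5.2). [FriedlanderIwaniecAnnals1998]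

## Mathlib / tree

Mathlib: `GaussianInt` (`Zsqrtd (-1)`, Euclidean domain), `Zsqrtd.norm`, `Zsqrtd.norm_mul`,
`Zsqrtd.norm_eq_mul_conj`, `Zsqrtd.norm_eq_of_associated`, `EuclideanDomain.gcd_eq_gcd_ab`,
`EuclideanDomain.dvd_gcd`, `associated_of_dvd_dvd`, `Nat.isCoprime_iff_coprime`. Tree: `fiBox`,
`fiRepCount`, `mem_fiBox_of_sq_le` (`FriedlanderIwaniecPrimes`). Mathlib has Fermat's two-squares
theorem (`Nat.Prime.sq_add_sq`) but no parametrisation of the representations of a product `mn` by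
pairs of representations, which is what (5.2) needs.
-/

noncomputable section

open Finset

namespace Literature.NumberTheory.Sieve.FriedlanderIwaniecPrimes

/-! ### `𝔷(b)` and the representations of `k` as a sum of two squares -/

/-- FI (3.14): `𝔷(b) = #{c ∈ ℤ : c² = b}` (`2` if `b` is a nonzero square, `1` if `b = 0`, `0` otherwise),
so that `a_n = Σ_{a² + b² = n} 𝔷(b)` ((3.1), (4.1)). [cite: FriedlanderIwaniecAnnals1998, (3.14)] -/
def fiZeta (b : ℤ) : ℕ := #((Icc (-(b.natAbs : ℤ)) b.natAbs).filter fun c => c ^ 2 = b)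

/-- Every `c` with `c² = b` lies in `[-|b|, |b|]`, so `fiZeta b` counts all of them. [folklore] -/
theorem mem_Icc_natAbs_of_sq_eq {b c : ℤ} (h : c ^ 2 = b) : c ∈ Icc (-(b.natAbs : ℤ)) b.natAbs := by
  have h1 : (c.natAbs : ℤ) ≤ c ^ 2 := Int.natAbs_le_self_sq c
  have h2 : (b.natAbs : ℤ) = b := by
    rw [Int.natAbs_of_nonneg]; rw [← h]; positivity
  rw [mem_Icc, h2]
  constructor <;> omega

/-- The representations `k = u² + v²`, `(u, v) ∈ ℤ²` (the Gaussian integers `w = u + iv` of norm `k`),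
inside the box `[-k, k]²`. [folklore] -/
def sqPairs (k : ℕ) : Finset (ℤ × ℤ) := (fiBox k).filter fun uv => uv.1 ^ 2 + uv.2 ^ 2 = (k : ℤ)

/-- Membership in `sqPairs k` is just `u² + v² = k` (the box is automatic). [folklore] -/
theorem mem_sqPairs {k : ℕ} {uv : ℤ × ℤ} : uv ∈ sqPairs k ↔ uv.1 ^ 2 + uv.2 ^ 2 = (k : ℤ) := by
  unfold sqPairs
  rw [mem_filter]
  constructor
  · exact fun h => h.2
  · intro h
    refine ⟨?_, h⟩
    have h1 : uv.1 ^ 2 ≤ (k : ℤ) := by nlinarith [sq_nonneg uv.2]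
    have h2 : uv.2 ^ 2 ≤ (k : ℤ) := by nlinarith [sq_nonneg uv.1]
    have := mem_fiBox_of_sq_le h1 h2
    simpa using this

/-- **`a_k = Σ_{x² + y² = k} 𝔷(x)`** ((3.1) with (3.14): the solutions of `a² + c⁴ = k` are the pairs
`(ζ, c)` with `ζ = c² + ia` of norm `k`). [cite: FriedlanderIwaniecAnnals1998, (3.1) and (3.14)] -/
theorem fiRepCount_eq_sum_fiZeta (k : ℕ) : fiRepCount k = ∑ xy ∈ sqPairs k, fiZeta xy.1 := by
  unfold fiRepCount
  set P : Finset (ℤ × ℤ) := {ac ∈ fiBox k | ac.1 ^ 2 + ac.2 ^ 4 = (k : ℤ)} with hP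
  -- fibre `P` over `sqPairs k` through `(a, c) ↦ (c², a)`
  have hmaps : (P : Set (ℤ × ℤ)).MapsTo (fun ac : ℤ × ℤ => (ac.2 ^ 2, ac.1)) (sqPairs k : Set (ℤ × ℤ)) := by
    intro ac hac
    have h := (mem_filter.mp (mem_coe.mp hac)).2
    refine mem_coe.mpr (mem_sqPairs.mpr ?_)
    nlinarith
  rw [card_eq_sum_card_fiberwise hmaps]
  refine sum_congr rfl fun xy hxy => ?_
  have hxy' := mem_sqPairs.mp hxy
  -- the fibre over `(x, y)` is `{(y, c) : c² = x}`
  apply card_bij (fun ac _ => ac.2)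
  · intro ac hac
    obtain ⟨hacP, hf⟩ := mem_filter.mp hac
    simp only [Prod.ext_iff] at hf
    exact mem_filter.mpr ⟨mem_Icc_natAbs_of_sq_eq hf.1, hf.1⟩
  · intro ac hac ac' hac' h
    obtain ⟨-, hf⟩ := mem_filter.mp hac
    obtain ⟨-, hf'⟩ := mem_filter.mp hac'
    simp only [Prod.ext_iff] at hf hf'
    exact Prod.ext (hf.2.trans hf'.2.symm) h
  · intro c hc
    obtain ⟨-, hc2⟩ := mem_filter.mp hc
    refine ⟨(xy.2, c), mem_filter.mpr ⟨mem_filter.mpr ⟨?_, ?_⟩, ?_⟩, rfl⟩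
    · apply mem_fiBox_of_sq_le
      · nlinarith [sq_nonneg xy.1]
      · rw [hc2]; nlinarith [sq_nonneg xy.2, sq_nonneg xy.1, sq_nonneg (xy.1 - 1), sq_nonneg (xy.1 + 1)]
    · simp only
      have : c ^ 4 = xy.1 ^ 2 := by rw [← hc2]; ring
      rw [this]; linarith
    · simp [hc2]


/-! ### Gaussian integers: coordinates, norm, and the map `(w, z) ↦ w̄ z` -/

open GaussianInt Zsqrtd

/-- `(u, v) ↦ u + iv`. [folklore] -/
def toGauss (p : ℤ × ℤ) : GaussianInt := ⟨p.1, p.2⟩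

/-- Real part of `toGauss`. [folklore] -/
@[simp] theorem toGauss_re (p : ℤ × ℤ) : (toGauss p).re = p.1 := rfl

/-- Imaginary part of `toGauss`. [folklore] -/
@[simp] theorem toGauss_im (p : ℤ × ℤ) : (toGauss p).im = p.2 := rfl

/-- `N(u + iv) = u² + v²`. [folklore] -/
theorem norm_toGauss (p : ℤ × ℤ) : (toGauss p).norm = p.1 ^ 2 + p.2 ^ 2 := by
  simp [toGauss, Zsqrtd.norm_def]; ring

/-- `toGauss` is injective. [folklore] -/
theorem toGauss_injective : Function.Injective toGauss := by
  intro p q h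
  have h1 := congrArg Zsqrtd.re h
  have h2 := congrArg Zsqrtd.im h
  simp only [toGauss_re, toGauss_im] at h1 h2
  exact Prod.ext h1 h2

/-- `z ↦ (Re z, Im z)`, the inverse of `toGauss`. [folklore] -/
def ofGauss (z : GaussianInt) : ℤ × ℤ := (z.re, z.im)

/-- `toGauss ∘ ofGauss = id`. [folklore] -/
@[simp] theorem toGauss_ofGauss (z : GaussianInt) : toGauss (ofGauss z) = z := by
  ext <;> rfl

/-- `ofGauss ∘ toGauss = id`. [folklore] -/
@[simp] theorem ofGauss_toGauss (p : ℤ × ℤ) : ofGauss (toGauss p) = p := rfl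

/-- In coordinates, `w̄ z` for `w = u + iv`, `z = r + is` is `(ur + vs) + i(us - vr)`. [folklore] -/
def gaussMulConj (uv rs : ℤ × ℤ) : ℤ × ℤ := (uv.1 * rs.1 + uv.2 * rs.2, uv.1 * rs.2 - uv.2 * rs.1)

/-- `toGauss (gaussMulConj w z) = star w * z`. [folklore] -/
theorem toGauss_gaussMulConj (uv rs : ℤ × ℤ) :
    toGauss (gaussMulConj uv rs) = star (toGauss uv) * toGauss rs := by
  ext
  · simp [toGauss, gaussMulConj, Zsqrtd.re_mul]
  · simp [toGauss, gaussMulConj, Zsqrtd.im_mul]; ring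

/-- `N(z) = k` for `z = toGauss p` iff `p ∈ sqPairs k`. [folklore] -/
theorem mem_sqPairs_iff_norm {k : ℕ} {p : ℤ × ℤ} : p ∈ sqPairs k ↔ (toGauss p).norm = k := by
  rw [mem_sqPairs, norm_toGauss]

/-- `ofGauss z ∈ sqPairs k` iff `N(z) = k`. [folklore] -/
theorem ofGauss_mem_sqPairs_iff {k : ℕ} {z : GaussianInt} : ofGauss z ∈ sqPairs k ↔ z.norm = k := by
  rw [mem_sqPairs_iff_norm, toGauss_ofGauss]

/-- `Φ` maps `sqPairs m × sqPairs n` into `sqPairs (mn)` (`N(w̄ z) = N(w) N(z)`). [folklore] -/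
theorem gaussMulConj_mem {m n : ℕ} {uv rs : ℤ × ℤ} (huv : uv ∈ sqPairs m) (hrs : rs ∈ sqPairs n) :
    gaussMulConj uv rs ∈ sqPairs (m * n) := by
  rw [mem_sqPairs] at huv hrs ⊢
  simp only [gaussMulConj]
  push_cast
  linear_combination (rs.1 ^ 2 + rs.2 ^ 2) * huv + (m : ℤ) * hrs

/-! ### The norm of `gcd(ζ, n)` -/

/-- `ζ ζ̄ = N(ζ)`. [folklore] -/
theorem mul_star_eq_norm (ζ : GaussianInt) : ζ * star ζ = (ζ.norm : GaussianInt) := (Zsqrtd.norm_eq_mul_conj ζ).symm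

/-- If `g ∣ ζ` then `ḡ ∣ ζ̄`. [folklore] -/
theorem star_dvd_star_of_dvd {g ζ : GaussianInt} (h : g ∣ ζ) : star g ∣ star ζ := by
  obtain ⟨c, rfl⟩ := h
  exact ⟨star c, by rw [star_mul']⟩

/-- **The key divisibility**: for coprime `m, n` and `N(ζ) = mn`, the Gaussian integer
`g = gcd(ζ, n)` has `g ḡ` associated with `n`; hence `N(g) = n`. (Bezout gives `n ∣ g ḡ`; `g ḡ`
divides both `ζ ζ̄ = mn` and `n²`, hence `n`.) [folklore] -/
theorem norm_gcd_eq {m n : ℕ} (hn : 0 < n) (hmn : m.Coprime n) {ζ : GaussianInt} (hζ : ζ.norm = m * n) :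
    (EuclideanDomain.gcd ζ (n : GaussianInt)).norm = n := by
  set g := EuclideanDomain.gcd ζ (n : GaussianInt) with hg
  have hζ' : ζ * star ζ = (m : GaussianInt) * n := by
    rw [mul_star_eq_norm, hζ]; push_cast; ring
  have hcop : IsCoprime (m : GaussianInt) (n : GaussianInt) := by
    have h := (Nat.isCoprime_iff_coprime.mpr hmn).map (Int.castRingHom GaussianInt)
    simpa using h
  -- (i) `n ∣ g ḡ` by Bezout
  have h1 : (n : GaussianInt) ∣ g * star g := by
    have hb := EuclideanDomain.gcd_eq_gcd_ab ζ (n : GaussianInt)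
    set a := EuclideanDomain.gcdA ζ (n : GaussianInt)
    set b := EuclideanDomain.gcdB ζ (n : GaussianInt)
    rw [← hg] at hb
    refine ⟨m * (a * star a) + (ζ * a * star b + b * (star ζ * star a) + n * (b * star b)), ?_⟩
    rw [hb, star_add, star_mul', star_mul', star_natCast]
    linear_combination (a * star a) * hζ'
  -- (ii) `g ḡ ∣ n`
  have h2 : g * star g ∣ (n : GaussianInt) := by
    have hgζ : g ∣ ζ := EuclideanDomain.gcd_dvd_left _ _
    have hgn : g ∣ (n : GaussianInt) := EuclideanDomain.gcd_dvd_right _ _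
    have ha : g * star g ∣ (m : GaussianInt) * n := by
      rw [← hζ']; exact mul_dvd_mul hgζ (star_dvd_star_of_dvd hgζ)
    have hb : g * star g ∣ (n : GaussianInt) * n := by
      have := mul_dvd_mul hgn (star_dvd_star_of_dvd hgn)
      rwa [star_natCast] at this
    obtain ⟨u, v, huv⟩ := hcop
    have e : (n : GaussianInt) = u * ((m : GaussianInt) * n) + v * ((n : GaussianInt) * n) := by
      linear_combination (-(n : GaussianInt)) * huv
    rw [e]
    exact dvd_add (dvd_mul_of_dvd_right ha u) (dvd_mul_of_dvd_right hb v)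
  -- (iii) associated, compare norms
  have hassoc : Associated (g * star g) (n : GaussianInt) := associated_of_dvd_dvd h2 h1
  have hnorm := Zsqrtd.norm_eq_of_associated (by norm_num) hassoc
  rw [Zsqrtd.norm_mul, Zsqrtd.norm_conj, Zsqrtd.norm_natCast] at hnorm
  have hg0 : 0 ≤ g.norm := GaussianInt.norm_nonneg g
  have hn0 : (0 : ℤ) ≤ n := by positivity
  nlinarith


/-! ### Existence and structure of the factorisations `ζ = w̄ z`, `N(w) = m`, `N(z) = n` -/

/-- `ε ε̄ = 1` for `N(ε) = 1`. [folklore] -/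
theorem mul_star_eq_one_of_norm {ε : GaussianInt} (h : ε.norm = 1) : ε * star ε = 1 := by
  rw [mul_star_eq_norm, h]; simp

/-- `z ≠ 0` when `N(z) = n > 0`. [folklore] -/
theorem ne_zero_of_norm_eq {z : GaussianInt} {n : ℕ} (hn : 0 < n) (h : z.norm = n) : z ≠ 0 := by
  intro h0
  rw [h0, Zsqrtd.norm_zero] at h
  have : (n : ℤ) = 0 := h.symm
  omega

/-- **Existence** ((5.2), "by the unique factorization in `ℤ[i]`"): for coprime `m, n ≥ 1` and
`N(ζ) = mn` there are `w, z` with `N(w) = m`, `N(z) = n`, `w̄ z = ζ` (take `z = gcd(ζ, n)`).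
[cite: FriedlanderIwaniecAnnals1998, (5.2)] -/
theorem exists_gauss_factor {m n : ℕ} (hn : 0 < n) (hmn : m.Coprime n) {ζ : GaussianInt}
    (hζ : ζ.norm = m * n) : ∃ w z : GaussianInt, w.norm = m ∧ z.norm = n ∧ star w * z = ζ := by
  set g := EuclideanDomain.gcd ζ (n : GaussianInt) with hg
  have hgn : g.norm = n := norm_gcd_eq hn hmn hζ
  have hg0 : g ≠ 0 := ne_zero_of_norm_eq hn hgn
  have hgζ : g ∣ ζ := EuclideanDomain.gcd_dvd_left _ _
  set q := ζ / g with hq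
  have hgq : g * q = ζ := EuclideanDomain.mul_div_cancel' hg0 hgζ
  refine ⟨star q, g, ?_, hgn, by rw [star_star, mul_comm, hgq]⟩
  have h := congrArg Zsqrtd.norm hgq
  rw [Zsqrtd.norm_mul, hζ, hgn] at h
  rw [Zsqrtd.norm_conj]
  have hn' : (n : ℤ) ≠ 0 := by exact_mod_cast hn.ne'
  have : (n : ℤ) * q.norm = n * m := by rw [h]; ring
  exact mul_left_cancel₀ hn' this

/-- **Uniqueness up to units**: two factorisations `w̄ z = w̄₀ z₀ = ζ` with `N(z) = N(z₀) = n ≥ 1`,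
`N(w₀) = m`, `(m, n) = 1` differ by a unit: `w = ε w₀`, `z = ε z₀`, `N(ε) = 1` (both `z, z₀` are
associated with `gcd(ζ, n)`; `N(w) = m` follows). [cite: FriedlanderIwaniecAnnals1998, (5.2)] -/
theorem gauss_factor_unique {m n : ℕ} (hn : 0 < n) (hmn : m.Coprime n) {ζ w₀ z₀ w z : GaussianInt}
    (hw₀ : w₀.norm = m) (hz₀ : z₀.norm = n) (h₀ : star w₀ * z₀ = ζ)
    (hz : z.norm = n) (h : star w * z = ζ) :
    ∃ ε : GaussianInt, ε.norm = 1 ∧ w = ε * w₀ ∧ z = ε * z₀ := by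
  have hζ : ζ.norm = m * n := by rw [← h₀, Zsqrtd.norm_mul, Zsqrtd.norm_conj, hw₀, hz₀]
  set g := EuclideanDomain.gcd ζ (n : GaussianInt) with hg
  have hgn : g.norm = n := norm_gcd_eq hn hmn hζ
  have hn' : (n : ℤ) ≠ 0 := by exact_mod_cast hn.ne'
  -- every admissible `z` divides `g`, with a cofactor of norm 1
  have key : ∀ z' : GaussianInt, z'.norm = n → z' ∣ ζ → ∃ q : GaussianInt, q.norm = 1 ∧ g = z' * q := by
    intro z' hz' hz'ζ
    have hz'n : z' ∣ (n : GaussianInt) := ⟨star z', by rw [mul_star_eq_norm, hz']; rfl⟩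
    obtain ⟨q, hq⟩ := EuclideanDomain.dvd_gcd hz'ζ hz'n
    refine ⟨q, ?_, hq⟩
    have h1 := congrArg Zsqrtd.norm hq
    rw [← hg, hgn, Zsqrtd.norm_mul, hz'] at h1
    have : (n : ℤ) * q.norm = n * 1 := by rw [← h1]; ring
    exact mul_left_cancel₀ hn' this
  obtain ⟨q, hq1, hgq⟩ := key z hz ⟨star w, by rw [← h]; ring⟩
  obtain ⟨q₀, hq₀1, hgq₀⟩ := key z₀ hz₀ ⟨star w₀, by rw [← h₀]; ring⟩
  -- `z = g q̄ = z₀ q₀ q̄`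
  have hzg : z = g * star q := by
    rw [hgq, mul_assoc, mul_star_eq_one_of_norm hq1, mul_one]
  refine ⟨q₀ * star q, ?_, ?_, ?_⟩
  · rw [Zsqrtd.norm_mul, Zsqrtd.norm_conj, hq₀1, hq1]; ring
  · -- `w̄ z = w̄₀ z₀` with `z = ε z₀`, `z₀ ≠ 0`
    have hz0 : z₀ ≠ 0 := ne_zero_of_norm_eq hn hz₀
    have hε : (q₀ * star q) * star (q₀ * star q) = 1 := by
      apply mul_star_eq_one_of_norm
      rw [Zsqrtd.norm_mul, Zsqrtd.norm_conj, hq₀1, hq1]; ring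
    have e1 : z = (q₀ * star q) * z₀ := by rw [hzg, hgq₀]; ring
    have e2 : (star w * (q₀ * star q) - star w₀) * z₀ = 0 := by
      have := h.trans h₀.symm
      rw [e1] at this
      linear_combination this
    have e3 : star w * (q₀ * star q) = star w₀ := by
      have := (mul_eq_zero.mp e2).resolve_right hz0
      exact sub_eq_zero.mp this
    have e4 : star w = star w₀ * star (q₀ * star q) := by
      calc star w = star w * ((q₀ * star q) * star (q₀ * star q)) := by rw [hε, mul_one]
        _ = (star w * (q₀ * star q)) * star (q₀ * star q) := by ring
        _ = star w₀ * star (q₀ * star q) := by rw [e3]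
    have := congrArg star e4
    rw [star_star, star_mul', star_star, star_star] at this
    rw [this]; ring
  · rw [hzg, hgq₀]; ring

/-! ### The fibres of `Φ` have exactly four elements -/

/-- The units in coordinates: `sqPairs 1 = {±1, ±i}`. [folklore] -/
theorem sqPairs_one : sqPairs 1 = {((1 : ℤ), (0 : ℤ)), (-1, 0), (0, 1), (0, -1)} := by
  ext ⟨u, v⟩
  rw [mem_sqPairs]
  simp only [mem_insert, mem_singleton, Prod.mk.injEq, Nat.cast_one]
  constructor
  · intro h
    have hu : -1 ≤ u ∧ u ≤ 1 := by constructor <;> nlinarith [sq_nonneg v, sq_nonneg (u - 1), sq_nonneg (u + 1)]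
    have hv : -1 ≤ v ∧ v ≤ 1 := by constructor <;> nlinarith [sq_nonneg u, sq_nonneg (v - 1), sq_nonneg (v + 1)]
    obtain ⟨hu1, hu2⟩ := hu
    obtain ⟨hv1, hv2⟩ := hv
    interval_cases u <;> interval_cases v <;> simp_all
  · rintro (⟨rfl, rfl⟩ | ⟨rfl, rfl⟩ | ⟨rfl, rfl⟩ | ⟨rfl, rfl⟩) <;> norm_num

/-- There are four units. [folklore] -/
theorem card_sqPairs_one : #(sqPairs 1) = 4 := by
  rw [sqPairs_one]; rfl

/-- The fibre of `Φ(w, z) = w̄ z` over `ζ`, in coordinates. [folklore] -/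
def gaussFibre (m n : ℕ) (ζp : ℤ × ℤ) : Finset ((ℤ × ℤ) × (ℤ × ℤ)) :=
  (sqPairs m ×ˢ sqPairs n).filter fun wz => gaussMulConj wz.1 wz.2 = ζp

/-- **Exactly four-to-one** ("where `1/4` accounts for the four units `1, i, i², i³` in `ℤ[i]`"):
for coprime `m, n ≥ 1` and `ζ` of norm `mn`, exactly four pairs `(w, z)` with `N(w) = m`, `N(z) = n`
have `w̄ z = ζ`. [cite: FriedlanderIwaniecAnnals1998, (5.2)] -/
theorem card_gaussFibre {m n : ℕ} (hn : 0 < n) (hmn : m.Coprime n) {ζp : ℤ × ℤ}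
    (hζp : ζp ∈ sqPairs (m * n)) : #(gaussFibre m n ζp) = 4 := by
  have hζ : (toGauss ζp).norm = m * n := by rw [← Nat.cast_mul]; exact mem_sqPairs_iff_norm.mp hζp
  obtain ⟨w₀, z₀, hw₀, hz₀, h₀⟩ := exists_gauss_factor hn hmn hζ
  have hz0 : z₀ ≠ 0 := ne_zero_of_norm_eq hn hz₀
  rw [← card_sqPairs_one]
  symm
  apply card_bij (fun e _ => (ofGauss (toGauss e * w₀), ofGauss (toGauss e * z₀)))
  · -- into the fibre
    intro e he
    have hε : (toGauss e).norm = 1 := by exact_mod_cast mem_sqPairs_iff_norm.mp he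
    refine mem_filter.mpr ⟨mem_product.mpr ⟨?_, ?_⟩, ?_⟩
    · rw [ofGauss_mem_sqPairs_iff, Zsqrtd.norm_mul, hε, hw₀, one_mul]
    · rw [ofGauss_mem_sqPairs_iff, Zsqrtd.norm_mul, hε, hz₀, one_mul]
    · apply toGauss_injective
      simp only [toGauss_gaussMulConj, toGauss_ofGauss]
      rw [star_mul']
      calc star (toGauss e) * star w₀ * (toGauss e * z₀)
          = (toGauss e * star (toGauss e)) * (star w₀ * z₀) := by ring
        _ = toGauss ζp := by rw [mul_star_eq_one_of_norm hε, one_mul, h₀]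
  · -- injective
    intro e _ e' _ h
    have h2 := congrArg (fun p : (ℤ × ℤ) × (ℤ × ℤ) => toGauss p.2) h
    simp only [toGauss_ofGauss] at h2
    exact toGauss_injective (mul_right_cancel₀ hz0 h2)
  · -- surjective
    intro wz hwz
    obtain ⟨hwz1, hwz2⟩ := mem_filter.mp hwz
    obtain ⟨-, hz1⟩ := mem_product.mp hwz1
    have hz : (toGauss wz.2).norm = n := by exact_mod_cast mem_sqPairs_iff_norm.mp hz1
    have h : star (toGauss wz.1) * toGauss wz.2 = toGauss ζp := by
      rw [← toGauss_gaussMulConj, hwz2]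
    obtain ⟨ε, hε, hwε, hzε⟩ := gauss_factor_unique hn hmn hw₀ hz₀ h₀ hz h
    refine ⟨ofGauss ε, ofGauss_mem_sqPairs_iff.mpr (by rw [hε]; rfl), ?_⟩
    simp only [toGauss_ofGauss]
    rw [← hwε, ← hzε, ofGauss_toGauss, ofGauss_toGauss]

/-! ### (5.2) -/

/-- **FI (5.2)**: for coprime `m, n ≥ 1`,
`4 a_{mn} = Σ_{|w|² = m} Σ_{|z|² = n} 𝔷(Re w̄ z) = Σ_{u² + v² = m} Σ_{r² + s² = n} 𝔷(ur + vs)`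
("Since `(m, n) = 1` we have by the unique factorization in `ℤ[i]` (5.2)
`a_{mn} = ¼ Σ_{|w|²=m} Σ_{|z|²=n} 𝔷(Re w̄ z)` where `¼` accounts for the four units").
[cite: FriedlanderIwaniecAnnals1998, (5.2)] -/
theorem four_mul_fiRepCount_eq_sum {m n : ℕ} (hn : 0 < n) (hmn : m.Coprime n) :
    4 * fiRepCount (m * n) =
      ∑ uv ∈ sqPairs m, ∑ rs ∈ sqPairs n, fiZeta (uv.1 * rs.1 + uv.2 * rs.2) := by
  have hmaps : ((sqPairs m ×ˢ sqPairs n : Finset ((ℤ × ℤ) × (ℤ × ℤ))) : Set ((ℤ × ℤ) × (ℤ × ℤ))).MapsTo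
      (fun wz => gaussMulConj wz.1 wz.2) (sqPairs (m * n) : Set (ℤ × ℤ)) := by
    intro wz hwz
    obtain ⟨h1, h2⟩ := mem_product.mp (mem_coe.mp hwz)
    exact mem_coe.mpr (gaussMulConj_mem h1 h2)
  have e : (∑ uv ∈ sqPairs m, ∑ rs ∈ sqPairs n, fiZeta (uv.1 * rs.1 + uv.2 * rs.2)) =
      ∑ wz ∈ sqPairs m ×ˢ sqPairs n, fiZeta (wz.1.1 * wz.2.1 + wz.1.2 * wz.2.2) :=
    (Finset.sum_product (sqPairs m) (sqPairs n)
      (fun wz => fiZeta (wz.1.1 * wz.2.1 + wz.1.2 * wz.2.2))).symm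
  rw [e, ← sum_fiberwise_of_maps_to hmaps]
  have hfib : ∀ ζp ∈ sqPairs (m * n),
      ∑ wz ∈ (sqPairs m ×ˢ sqPairs n).filter (fun wz => gaussMulConj wz.1 wz.2 = ζp),
        fiZeta (wz.1.1 * wz.2.1 + wz.1.2 * wz.2.2) = 4 * fiZeta ζp.1 := by
    intro ζp hζp
    rw [sum_congr rfl (g := fun _ => fiZeta ζp.1), sum_const, smul_eq_mul]
    · rw [show ((sqPairs m ×ˢ sqPairs n).filter (fun wz => gaussMulConj wz.1 wz.2 = ζp)) =
        gaussFibre m n ζp from rfl, card_gaussFibre hn hmn hζp]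
    · intro wz hwz
      have h := (mem_filter.mp hwz).2
      rw [← h]; rfl
  rw [sum_congr rfl hfib, ← mul_sum, fiRepCount_eq_sum_fiZeta]

end Literature.NumberTheory.Sieve.FriedlanderIwaniecPrimes
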